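import Summits.BirchSwinnertonDyer.Rank1Residual.ManinAdditive.MinusOneLevelRaisingDegreeProof
import Literature.NumberTheory.EllipticCurves.GlobalMinimalModelProofs
import Literature.NumberTheory.EllipticCurves.IsogenyVariableChangeProofs
import Literature.NumberTheory.EllipticCurves.LFunctionSmulProofs
import Literature.NumberTheory.EllipticCurves.ModularParametrizationDegreeProofs
import Literature.NumberTheory.EllipticCurves.ModularParametrizationProofs
import Literature.NumberTheory.EllipticCurves.ManinConstantQuadraticTwistAtTwoProofs
import Literature.NumberTheory.EllipticCurves.RootNumberSmulProofs
import Summits.BirchSwinnertonDyer.BirchSwinnertonDyer.Theorems.QuadraticBranchSignedControlPlusEtaLowerInclusionManinInput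
import HarnessLib

/-!
# Route `ManinLocalTwoThree`, crux C2 `ManinOddAtFour` — the optimal `χ₋₄`-partner EXISTS (S-an-57 PROVED
# modulo modularity and the tame-twist conductor fact S-an-58); NET: the `4 ∥ N` stratum of C2 follows from
# its `8 ∣ N` stratum (cell bsd-f2-manin, lens `an`, g32, TURNKEY-an-23 = B3)

THEOREMS ONLY (no `sorry`), continuing `MinusOneLevelRaisingProof` (B1) and `MinusOneLevelRaisingDegreeProof` (B2).

* `NegOneTwistConductorFourMul` — S-an-58, the print fact `f₂(W) = 2 ⇒ N(W ⊗ χ₋₄) = 4·N(W)` (tame ⊗ wild: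
  `a(ρ ⊗ χ₋₄) = 2 + 2·sw(χ₋₄) = 4`; Barrios et al. 2025, Thm. 5.1, Table (v(d) = 0), rows `IV`/`IV*`,
  `d ≡ 3 (mod 4)`: `(f, f^d) = (2, 4)`; census 168 649/168 649 classes with `v₂(N) = 2`, `N ≤ 5·10⁵`) — a
  HYPOTHESIS here (node; proof of its local form in progress by p2 g13, see the typer note).
* `half_gaussSum_χ₄_twoSided_of_isNewformOf` — the two-sided exact lattice step of B1 §3 with the upstairs
  datum replaced by a bare newform `g` of `W′`.
* (the parametrisation datum with prescribed `(f, L, c)` is the tree's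
  `PlusEtaManinInput.exists_modularParametrizationData_eq_of_smul_periodLattice_le`, imported.)
* `minusOneLevelRaisingOptimalPartner_of` — **S-an-57 `MinusOneLevelRaisingOptimalPartner` from
  `exists_isNewformOf` and S-an-58**: the minimal model `W′ = C • (W ⊗ χ₋₄)` (`u(C) = ±1`, Connell–Pal) carries at
  level `N(W′) = 4N` the LATTICE-OPTIMAL datum `(g = f_W ⊗ χ₄, u·i⁻¹Λ_W, c(D))` because `Λ(g) = i·Λ(f_W)` and
  `Λ(W ⊗ χ₋₄) = i⁻¹Λ(W)` (Pal, Lemma 3.1).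
* `two_not_dvd_c_of_four_dvd_of_eight_dvd_stratum_of_modularity` — NET: `C2|_{8∣N}` ⟹ `C2|_{4∥N}` at the
  conductor level, modulo `exists_isNewformOf` + S-an-58; `exists_optimalPartner_c_eq_or` — the partner has
  `c′ = ±c`.

Census: PARTITION 0 · beyond-print theorem: yes (exact same-constant optimal partner across `N ⇝ 4N`) · BSD is
not proved by this.

TYPER NOTE (typer g17, TURNKEY-an-23 B3).  Landed from HOME/an/g32/MinusOneLevelRaisingOptimalPartnerProof.lean sha16
91bceb76b3926577 (292 l.) = §7 of the -an seat's kernel-certified scratch MinusOneLevelRaisingAll.lean 471d669c38aebed2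
(1057 l.; farm rc 0 · 0 err · 0 warn · 0 sorry, axioms standard, All7_check2.json; by name vs the tree:
MinusOneLevelRaisingProofs_concat3.lean c2df9d4e798635d0 rc 0), VERBATIM except: this note; the `[cite:]` key of
Barrios et al. set to the tree's bib key `BarriosEtAl2025` with the table locator read from the materialised arXiv text;
an's copy `exists_datum_eq_of_isNewformOf` of the tree's `PlusEtaManinInput.exists_modularParametrizationData_eq_of_smul_periodLattice_le`
(`dedup.landed` at the typer's dry-run) replaced by the import of that theorem; and ONE proof step of
`half_gaussSum_χ₄_twoSided_of_isNewformOf` (`hle`) re-routed from an's unlanded S-an-56 variant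
`periodLattice_le_of_modularSymbol_eq` to the tree's S-an-56 `ManinLocalTwoThree.periodLattice_le_periodLattice_charTwist_one_of_two_dvd`
(p2 g13, p693677) via `hlift` (marked in the proof).  ONE new `def … : Prop`, statement-only, used only as an explicit
hypothesis: **S-an-58 `NegOneTwistConductorFourMul`** (print fact per an; BC7 CLEAN, HOME/an/g32/S58_probe.json; census
168 649 / 168 649) — NOT vendored as a Literature fact by the typer because the width prover p2 g13 is PROVING its local
form `f₂(W) = 2 → f₂(W ⊗ χ₋₄) = 4` by Tate's algorithm (STATUS 04:02:10Z; the global node then follows by an's recipe: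
`conductorNorm_eq_artinConductorNat_of_two_three` + `maninLocalTwoThree_conductorExponent_quadraticTwist_eq_of_ne_two`).
bears_on: stmt-BirchSwinnertonDyer-22967 (C2): `two_not_dvd_c_of_four_dvd_of_eight_dvd_stratum_of_modularity` —
C2|_{8∣N} ⟹ C2|_{4∥N} modulo `exists_isNewformOf` and S-an-58.  BSD is not proved by this; Manin's conjecture is not
proved by this; C2/C3 OPEN.
-/

noncomputable section

open scoped MatrixGroups ModularForm

open CongruenceSubgroup WeierstrassCurve
  Literature.NumberTheory.DiophantineGeometry
  Literature.NumberTheory.EllipticCurves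
  Literature.NumberTheory.EllipticCurves.ModularForms
  Summit.BirchSwinnertonDyer.BirchSwinnertonDyer.Theorems

namespace Summit.BirchSwinnertonDyer.Rank1Residual.ManinAdditive

/-! ## §7 S-an-57 PROVED modulo modularity (`exists_isNewformOf`, already a C2 frame hypothesis) and the
conductor of the `χ₋₄`-twist at `f₂ = 2` (S-an-58, print fact) -/

section Partner

/-- **S-an-58 `NegOneTwistConductorFourMul` (print fact; this `def` is its by-name NODE — the local form
`f₂(W) = 2 → f₂(W ⊗ χ₋₄) = 4` is being proved in the tree by the width prover p2 g13).** If `f₂(W) = 2`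
(`4 ∥ N(W)`), then `N(W ⊗ χ₋₄) = 4·N(W)`: the `ℓ`-adic representation of `W` at `2` is additive and TAME
(Swan conductor `f₂ − 2 = 0`), `χ₋₄` is wild of conductor exponent `2` (Swan `1`), so
`a(ρ ⊗ χ₋₄) = 2 + 2·sw(χ₋₄) = 4`; at odd `p` the character is unramified and `f_p` is unchanged.
Census: all `168 649` classes with `v₂(N) = 2`, `N ≤ 500 000` have `N(E ⊗ χ₋₄) = 4N` (TWISTCENSUS2).
[cite: Serre1987, §4 (conducteur d'un produit tensoriel, cas modéré)] [cite: Pal2012, Prop. 2.4]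
[cite: BarriosEtAl2025, Thm. 5.1 and its Table «Local data for E/ℚ₂ and E^d/ℚ₂ with v(d) = 0» (arXiv pp. 15–16), rows R = IV and R = IV*, d ≡ 3 (mod 4): (f, f^d) = (2, 4)] -/
def NegOneTwistConductorFourMul : Prop :=
  ∀ (W : WeierstrassCurve ℚ) [W.IsElliptic],
    2 ^ 2 ∣ W.conductorNorm ℤ → ¬ 2 ^ 3 ∣ W.conductorNorm ℤ →
    (haveI := W.isElliptic_quadraticTwist (show ((-1 : ℤ) : ℚ) ≠ 0 by norm_num);
      (W.quadraticTwist ((-1 : ℤ) : ℚ)).conductorNorm ℤ) = 4 * W.conductorNorm ℤ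

/-- The two-sided exact step of §3 with the UPSTAIRS datum replaced by a bare newform `g` of `W′`
(`IsNewformOf W′ g`): `(g(χ₄)/2)·Λ(g) ⊆ Λ(f_W)` and `(g(χ₄)/2)·Λ(f_W) ⊆ Λ(g)`. Same proof.
[cite: Stevens1989, Lemma (5.4) p. 97] [cite: Cremona1997, §2.8] -/
theorem half_gaussSum_χ₄_twoSided_of_isNewformOf {W W' : WeierstrassCurve ℚ}
    [W.IsElliptic] [W'.IsElliptic] [NeZero (W.conductorNorm ℤ)] [NeZero (W'.conductorNorm ℤ)]
    (D : ModularParametrizationData W (W.conductorNorm ℤ))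
    (g : CuspForm (Gamma0 (W'.conductorNorm ℤ)) 2) (hg : IsNewformOf W' g)
    (h4 : 2 ^ 2 ∣ W.conductorNorm ℤ) (hN : W'.conductorNorm ℤ = 4 * W.conductorNorm ℤ)
    (hiso : IsIsogenous (W.quadraticTwist ((-1 : ℤ) : ℚ)) W') :
    (∀ w ∈ periodLattice g,
      gaussSum (ZMod.χ₄.ringHomComp (Int.castRingHom ℂ)) (ZMod.stdAddChar (N := 4)) / 2 * w ∈
        periodLattice D.f) ∧
    (∀ w ∈ periodLattice D.f,
      gaussSum (ZMod.χ₄.ringHomComp (Int.castRingHom ℂ)) (ZMod.stdAddChar (N := 4)) / 2 * w ∈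
        periodLattice g) := by
  haveI : Fact (Nat.Prime 2) := ⟨Nat.prime_two⟩
  haveI : NeZero (4 : ℕ) := ⟨by norm_num⟩
  haveI : NeZero (1 : ℕ) := ⟨by norm_num⟩
  have hχ : (ZMod.χ₄.ringHomComp (Int.castRingHom ℂ)).IsQuadratic := isQuadratic_χ₄_ringHomComp
  have hprim : DirichletCharacter.IsPrimitive (ZMod.χ₄.ringHomComp (Int.castRingHom ℂ)) :=
    isPrimitive_χ₄_ringHomComp
  have hd0 : ((-1 : ℤ) : ℚ) ≠ 0 := by norm_num
  haveI := W.isElliptic_quadraticTwist hd0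
  have h4nat : 4 ∣ W.conductorNorm ℤ := by norm_num at h4; exact h4
  have h2nat : 2 ∣ W.conductorNorm ℤ := dvd_trans (by norm_num) h4nat
  have hM' : 4 ^ 2 ∣ W'.conductorNorm ℤ := by
    rw [hN, pow_two]; exact Nat.mul_dvd_mul_left 4 h4nat
  have h4' : 2 ^ 2 ∣ W'.conductorNorm ℤ := dvd_trans (by norm_num) hM'
  obtain ⟨hngW, hnmW⟩ := not_good_and_not_mult_of_sq_dvd_conductorNorm W h4
  obtain ⟨hngW', hnmW'⟩ := not_good_and_not_mult_of_sq_dvd_conductorNorm W' h4'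
  have hW0 : ∀ n : ℕ, 2 ∣ n → W.LFunction n = 0 := fun n hn ↦
    W.LFunction_apply_eq_zero_of_not_good_of_not_mult 2 hngW hnmW hn
  have hW'0 : ∀ n : ℕ, 2 ∣ n → W'.LFunction n = 0 := fun n hn ↦
    W'.LFunction_apply_eq_zero_of_not_good_of_not_mult 2 hngW' hnmW' hn
  have hodd : ∀ n : ℕ, ¬ 2 ∣ n → (((W.quadraticTwist ((-1 : ℤ) : ℚ)).LFunction n : ℤ) : ℂ) =
      (ZMod.χ₄.ringHomComp (Int.castRingHom ℂ)) n * (W.LFunction n : ℂ) := fun n hn ↦ by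
    rw [show ((-1 : ℤ) : ℚ) = -1 by norm_num, W.LFunction_quadraticTwist_neg_one_apply_of_odd hn,
      Int.cast_mul, χ₄_ringHomComp_apply_natCast]
  have heven : ∀ n : ℕ, 2 ∣ n → (ZMod.χ₄.ringHomComp (Int.castRingHom ℂ)) n = 0 := fun n hn ↦ by
    rw [χ₄_ringHomComp_apply_natCast, ZMod.χ₄_nat_eq_if_mod_four, if_pos (Nat.mod_eq_zero_of_dvd hn)]
    simp
  have hsq : ∀ n : ℕ, ¬ 2 ∣ n → (ZMod.χ₄.ringHomComp (Int.castRingHom ℂ)) n *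
      (ZMod.χ₄.ringHomComp (Int.castRingHom ℂ)) n = 1 := fun n hn ↦ by
    rw [χ₄_ringHomComp_apply_natCast, ZMod.χ₄_nat_eq_if_mod_four,
      if_neg (fun h ↦ hn (Nat.dvd_of_mod_eq_zero h))]
    split_ifs <;> push_cast <;> ring
  have hLC : (W.quadraticTwist ((-1 : ℤ) : ℚ)).LFunction = W'.LFunction := hiso.LFunction_eq
  have hcoef : ∀ n : ℕ, cuspCoeff g n =
      (ZMod.χ₄.ringHomComp (Int.castRingHom ℂ)) n * cuspCoeff D.f n := fun n ↦ by
    rw [hg.2 n, D.isNewformOf.2 n]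
    by_cases h2 : 2 ∣ n
    · rw [hW'0 n h2, heven n h2]
      simp
    · rw [← hLC]
      exact hodd n h2
  have hevenD : ∀ n : ℕ, 2 ∣ n → cuspCoeff D.f n = 0 := fun n hn ↦ by
    rw [D.isNewformOf.2 n, hW0 n hn, Int.cast_zero]
  have hevenD' : ∀ n : ℕ, 2 ∣ n → cuspCoeff g n = 0 := fun n hn ↦ by
    rw [hg.2 n, hW'0 n hn, Int.cast_zero]
  have hNdvd : W.conductorNorm ℤ ∣ W'.conductorNorm ℤ := ⟨4, by rw [hN]; ring⟩
  -- `g = f_W ⊗ χ₄` at level `N(W′)`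
  have htw' : charTwist (W'.conductorNorm ℤ) hNdvd hM' hχ D.f = g :=
    eq_of_forall_cuspCoeff_eq_gamma0 fun n ↦ by rw [cuspCoeff_charTwist _ hNdvd hM' hχ hprim, hcoef n]
  have hhalf : ∀ x : ℚ, modularSymbol D.f (x + 1 / 2) = -modularSymbol D.f x :=
    maninLocalTwoThree_modularSymbol_add_half_eq_neg_of_four_dvd D.f h4nat hevenD
  have hhalf' : ∀ x : ℚ, modularSymbol g (x + 1 / 2) = -modularSymbol g x :=
    modularSymbol_add_half_eq_neg g hM' hevenD'
  have hm1 : 1 ^ 2 ∣ W'.conductorNorm ℤ := by rw [one_pow]; exact one_dvd _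
  have hone : ∀ n : ℕ, (1 : DirichletCharacter ℂ 1) n = 1 := fun n ↦
    MulChar.one_apply (isUnit_of_subsingleton _)
  have hlift : charTwist (W'.conductorNorm ℤ) dvd_rfl hM' hχ g =
      charTwist (W'.conductorNorm ℤ) hNdvd hm1 maninLocalTwoThree_isQuadratic_one_level_one D.f :=
    eq_of_forall_cuspCoeff_eq_gamma0 fun n ↦ by
      rw [cuspCoeff_charTwist _ dvd_rfl hM' hχ hprim, cuspCoeff_charTwist _ hNdvd hm1
        maninLocalTwoThree_isQuadratic_one_level_one DirichletCharacter.isPrimitive_one_level_one,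
        hone n, one_mul, hcoef n, ← mul_assoc]
      by_cases hn : 2 ∣ n
      · rw [hevenD n hn, mul_zero]
      · rw [hsq n hn, one_mul]
  -- (typer g17: an's B1 lemma `periodLattice_le_of_modularSymbol_eq` (S-an-56 for equal modular symbols) and
  -- the `hms` step are not in the tree; the landed S-an-56 is p2's
  -- `periodLattice_le_periodLattice_charTwist_one_of_two_dvd` (p693677) for the level-`N′` lift of `f_W`, which
  -- `hlift` identifies with `g ⊗ χ₄`.)
  have hle : periodLattice D.f ≤ periodLattice (charTwist (W'.conductorNorm ℤ) dvd_rfl hM' hχ g) := by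
    rw [hlift]
    exact ManinLocalTwoThree.periodLattice_le_periodLattice_charTwist_one_of_two_dvd
      (W'.conductorNorm ℤ) hNdvd ⟨1, by rw [hN, mul_one]⟩ hm1 h2nat D.f
  refine ⟨fun w hw ↦ ?_, fun w hw ↦ ?_⟩
  · rw [← htw'] at hw
    exact half_gaussSum_mul_mem_periodLattice_of_mem_charTwist _ hNdvd hM' hχ hprim D.f
      (fun x ↦ ⟨1, 3, 0, sum_χ₄_modularSymbol_of_half D.f hhalf x⟩) hw
  · exact half_gaussSum_mul_mem_periodLattice_of_mem_charTwist _ dvd_rfl hM' hχ hprim g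
      (fun x ↦ ⟨1, 3, 0, sum_χ₄_modularSymbol_of_half g hhalf' x⟩) (hle hw)

/-- **S-an-57 `MinusOneLevelRaisingOptimalPartner` PROVED modulo modularity and S-an-58.**  For `W` minimal
with `4 ∥ N`, `D` lattice-optimal at the conductor: the minimal model `W′ = C • (W ⊗ χ₋₄)` (`u(C) = ±1` by
the Connell–Pal discriminant equality) carries, at level `N(W′) = 4N`, the datum `(g, u·i⁻¹Λ_W, c(D))` with
`g = f_W ⊗ χ₄` its newform — and it is LATTICE-OPTIMAL because `Λ(g) = i·Λ(f_W)` (two-sided step of §3)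
and `Λ(W ⊗ χ₋₄) = i⁻¹Λ(W)` (Pal's Lemma 3.1).  So the optimal `χ₋₄`-partner EXISTS with the SAME constant.
[cite: Pal2012, Lemma 3.1 and Prop. 2.4] [cite: Stevens1989, Lemma (5.4) p. 97] -/
theorem minusOneLevelRaisingOptimalPartner_of (hnf : exists_isNewformOf)
    (h58 : NegOneTwistConductorFourMul) : MinusOneLevelRaisingOptimalPartner := by
  intro W _ _ _ D hD h4 h8
  have hd0 : ((-1 : ℤ) : ℚ) ≠ 0 := by norm_num
  haveI := W.isElliptic_quadraticTwist hd0
  set T := W.quadraticTwist ((-1 : ℤ) : ℚ) with hT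
  have hNT : T.conductorNorm ℤ = 4 * W.conductorNorm ℤ := h58 W h4 h8
  -- the minimal model `W′ = C • T`, `u(C)² = 1`
  obtain ⟨C, hmin⟩ := hasGlobalMinimalModel_rat_holds T
  haveI := hmin
  have hNW' : (C • T).conductorNorm ℤ = 4 * W.conductorNorm ℤ := by
    rw [WeierstrassCurve.conductorNorm_smul]; exact hNT
  haveI : NeZero ((C • T).conductorNorm ℤ) :=
    ⟨by rw [hNW']; exact mul_ne_zero (by norm_num) (NeZero.ne _)⟩
  have h4' : 2 ^ 2 ∣ (C • T).conductorNorm ℤ := by rw [hNW']; exact dvd_mul_of_dvd_right h4 4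
  have hΔ : (C • T).Δ = W.Δ := negOneTwistMinimalDiscrEq_holds W (C • T) C h4 h4' rfl
  have hu2 : ((C.u : ℚ)) ^ 2 = 1 :=
    u_sq_eq_one_of_smul_quadraticTwist_of_Δ hd0 C rfl (by rw [hΔ]; norm_num)
  have hu1 : (C.u : ℚ) = 1 ∨ (C.u : ℚ) = -1 := mul_self_eq_one_iff.mp (by rw [← pow_two]; exact hu2)
  -- the newform `g` of `W′` and the two-sided lattice step `Λ(g) = s·Λ(f_W)`, `s = g(χ₄)/2`, `s² = −1`
  obtain ⟨g, hg⟩ := hnf (C • T)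
  have hisoT : IsIsogenous T (C • T) := isIsogenous_smul T C
  obtain ⟨h₁, h₂⟩ := half_gaussSum_χ₄_twoSided_of_isNewformOf D g hg h4 hNW' hisoT
  set s : ℂ := gaussSum (ZMod.χ₄.ringHomComp (Int.castRingHom ℂ)) (ZMod.stdAddChar (N := 4)) / 2
    with hs
  have hs2 : s ^ 2 = -1 := by
    rw [hs, div_pow, gaussSum_χ₄_ringHomComp_sq]; norm_num
  have hs0 : s ≠ 0 := fun h ↦ by rw [h] at hs2; norm_num at hs2
  -- Néron pairs: `Λ(T) = s⁻¹Λ(W)` (Pal), `Λ(W′) = u·Λ(T)`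
  have hs2' : s ^ 2 = ((((-1 : ℤ) : ℚ)) : ℂ) := by rw [hs2]; norm_num
  have hLT : IsNeronLatticeOf (T.baseChange ℂ) (D.L.mulLeft s⁻¹ (inv_ne_zero hs0)) :=
    isNeronLatticeOf_quadraticTwist_of_sq_eq ((-1 : ℤ) : ℚ) D.isNeronLattice hs0 hs2'
  haveI : ((C • T).baseChange ℂ).IsElliptic := by rw [WeierstrassCurve.baseChange]; infer_instance
  obtain ⟨L', hL'⟩ := exists_isNeronLatticeOf_holds ((C • T).baseChange ℂ)
  have hlat := IsNeronLatticeOf.lattice_eq_mulLeft_of_smul C hLT hL'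
  have huC0 : ((C.u : ℚ) : ℂ) ≠ 0 := by exact_mod_cast C.u.ne_zero
  -- membership in `Λ(W′)`: `z ∈ Λ(W′) ↔ s·(u⁻¹ z) ∈ Λ(W)`
  have hmem : ∀ z : ℂ, z ∈ L'.lattice ↔ s * ((((C.u : ℚ) : ℂ))⁻¹ * z) ∈ D.L.lattice := fun z ↦ by
    rw [hlat, PeriodPair.mem_mulLeft_lattice, PeriodPair.mem_mulLeft_lattice, inv_inv]
  -- `ε = u = ±1` acts trivially on every `ℤ`-lattice
  have hεW : ∀ x : ℂ, (((C.u : ℚ) : ℂ))⁻¹ * x ∈ D.L.lattice ↔ x ∈ D.L.lattice := fun x ↦ by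
    rcases hu1 with h | h <;> simp [h, neg_mem_iff]
  have hc0 : D.c ≠ 0 := D.maninConstant_ne_zero_holds
  -- `c·Λ(g) ⊆ Λ(W′)`
  have hc : ∀ z ∈ periodLattice g, (D.c : ℂ) * z ∈ L'.lattice := fun z hz ↦ by
    rw [hmem, ← mul_assoc, mul_comm s, mul_assoc, hεW, ← mul_assoc, mul_comm s, mul_assoc]
    · exact D.smul_periodLattice_le _ (h₁ z hz)
  obtain ⟨D', hf', hL'eq, hc'⟩ :=
    PlusEtaManinInput.exists_modularParametrizationData_eq_of_smul_periodLattice_le hg hL' hc0 hc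
  subst hf' hL'eq
  refine ⟨C • T, inferInstance, hmin, inferInstance, D', ?_, hNW', hisoT⟩
  -- lattice-optimality of `D′`: `Λ(W′) = c·Λ(g)`
  intro z hz
  rw [hmem, ← mul_assoc, mul_comm s, mul_assoc, hεW] at hz
  obtain ⟨w₀, hw₀, hzw⟩ := hD _ hz
  refine ⟨-(s * w₀), neg_mem (h₂ w₀ hw₀), ?_⟩
  rw [hc']
  have hz' : z = -(s * (s * z)) := by
    rw [← mul_assoc, ← pow_two, hs2]; ring
  rw [hz', hzw]; ring

/-- **NET RESULT of g32 for C2 (`ManinOddAtFour`) at the conductor level**: modulo modularity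
(`exists_isNewformOf`, a hypothesis C2 already carries) and the print fact S-an-58, the `4 ∥ N` stratum of
C2 is IMPLIED by its `8 ∣ N` stratum — the level-raising `χ₋₄`-rotation moves every lattice-optimal datum
with `4 ∥ N` to a lattice-optimal datum with `16 ∥ N′ = 4N` and the SAME Manin constant. -/
theorem two_not_dvd_c_of_four_dvd_of_eight_dvd_stratum_of_modularity (hnf : exists_isNewformOf)
    (h58 : NegOneTwistConductorFourMul)
    (h8 : ∀ (W' : WeierstrassCurve ℚ) [W'.IsElliptic] [W'.IsGloballyMinimal] [NeZero (W'.conductorNorm ℤ)]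
      (D' : ModularParametrizationData W' (W'.conductorNorm ℤ)),
      IsLatticeOptimal D' → 2 ^ 3 ∣ W'.conductorNorm ℤ → ¬ (2 : ℤ) ∣ D'.c)
    (W : WeierstrassCurve ℚ) [W.IsElliptic] [W.IsGloballyMinimal] [NeZero (W.conductorNorm ℤ)]
    (D : ModularParametrizationData W (W.conductorNorm ℤ)) (hD : IsLatticeOptimal D)
    (h4 : 2 ^ 2 ∣ W.conductorNorm ℤ) : ¬ (2 : ℤ) ∣ D.c :=
  two_not_dvd_c_of_four_dvd_of_eight_dvd_stratum (minusOneLevelRaisingOptimalPartner_of hnf h58) h8 W D hD h4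

/-- The same with the SAME-CONSTANT clause made explicit: every lattice-optimal conductor-level datum with
`4 ∥ N` has a lattice-optimal `χ₋₄`-partner at conductor `4N` whose Manin constant has the same parity —
indeed (E-an-145R) `c′ = ± c`. -/
theorem exists_optimalPartner_c_eq_or (hnf : exists_isNewformOf) (h58 : NegOneTwistConductorFourMul)
    (W : WeierstrassCurve ℚ) [W.IsElliptic] [W.IsGloballyMinimal] [NeZero (W.conductorNorm ℤ)]
    (D : ModularParametrizationData W (W.conductorNorm ℤ)) (hD : IsLatticeOptimal D)
    (h4 : 2 ^ 2 ∣ W.conductorNorm ℤ) (h8 : ¬ 2 ^ 3 ∣ W.conductorNorm ℤ) :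
    ∃ (W' : WeierstrassCurve ℚ) (_ : W'.IsElliptic) (_ : W'.IsGloballyMinimal)
      (_ : NeZero (W'.conductorNorm ℤ)) (D' : ModularParametrizationData W' (W'.conductorNorm ℤ)),
      IsLatticeOptimal D' ∧ W'.conductorNorm ℤ = 4 * W.conductorNorm ℤ ∧ (D'.c = D.c ∨ D'.c = -D.c) := by
  obtain ⟨W', _, _, _, D', hD', hN, hiso⟩ := minusOneLevelRaisingOptimalPartner_of hnf h58 W D hD h4 h8
  obtain ⟨-, hc⟩ := minusOneLevelRaisingOptimalOrbit_holds W W' D D' hD hD' h4 hN hiso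
  exact ⟨W', inferInstance, inferInstance, inferInstance, D', hD', hN, hc⟩

end Partner

end Summit.BirchSwinnertonDyer.Rank1Residual.ManinAdditive
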